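import Literature.Analysis.SpecialFunctions.PolygammaStirlingSeries
import Literature.NumberTheory.LFunctions.ZetaCertifiedEvaluation
import HarnessLib

/-!
# Rational Euler–Maclaurin enclosures of the Hurwitz-type sums `Σ_{k≥0} (k+c)^{-s}` (`c ∈ ℚ_{>0}`, integers `s ≥ 2`)

Topic `Literature/Analysis/SpecialFunctions`.  The kernel form of `PolygammaStirlingSeries.norm_tsum_inv_pow_sub_stirling_le`:
for a rational `c > 0` and integers `s ≥ 2`, `J`, `ν ≥ 1` the Euler–Maclaurin main terms with shift `J`,

  (computably: the Bernoulli numbers come from the memoised table `ZetaNumerics.emCoeffList`, so `decide` and `#eval` evaluate it)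

  `hurwitzNatMain c J ν s = Σ_{k<J} (k+c)^{−s} + 1/((s−1)(c+J)^{s−1}) + 1/(2(c+J)^s)`
  `                          + Σ_{k=1}^{ν} (B_{2k}/(2k)!) s(s+1)⋯(s+2k−2)/(c+J)^{s+2k−1}  ∈ ℚ`,

and the remainder majorant `hurwitzNatTail c J ν s = s(s+1)⋯(s+2ν)·(33/10)(25/157)^{2ν+1}/(c+J)^{s+2ν} ∈ ℚ`
(`π²/3 ≤ 33/10`, `1/(2π) ≤ 25/157`, as in `EulerMaclaurinZetaHigher.norm_emRemHigher_le_rat` and `Xiao2020/ZetaNatEM.lean`,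
which is the case `c = 1`), with **`abs_tsum_inv_pow_sub_hurwitzNatMain_le`**:
`|Σ_{k≥0} (k+c)^{−s} − hurwitzNatMain c J ν s| ≤ hurwitzNatTail c J ν s` (and the series is summable).
E.g. `c = ¼`, `J = 40`, `ν = 20` gives `ζ(s, ¼)` — hence `ψ^{(s−1)}(¼)`, `β(s)`-type constants and the main parts
`p!·2^{−(p+1)} ζ(p+1, ¼)` of the C∞ window constants of the Weil-positivity kernel certificates — to `≈ 50` digits by `decide`.
Everything is proved. [cite: DLMF, 25.11.5]
-/

noncomputable section

open Complex Real Finset Literature.NumberTheory.LFunctions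

namespace Literature.Analysis.SpecialFunctions

open Literature.Analysis.SpecialFunctions.Complex

/-- The Euler–Maclaurin main terms of order `ν` with shift `J` for the Hurwitz-type sum `Σ_{k≥0} (k+c)^{−s}` (`s ≥ 2` an
integer, `c` rational), as a rational number:
`Σ_{k<J} (k+c)^{−s} + 1/((s−1)(c+J)^{s−1}) + 1/(2(c+J)^s) + Σ_{k=1}^{ν} (B_{2k}/(2k)!) s^{(2k−1)} /(c+J)^{s+2k−1}`.
[cite: DLMF, 25.11.5] -/
def hurwitzNatMain (c : ℚ) (J ν s : ℕ) : ℚ :=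
  let cs := ZetaNumerics.emCoeffList ν
  (∑ k ∈ Finset.range J, 1 / ((k : ℚ) + c) ^ s) +
    1 / (((s : ℚ) - 1) * (c + J) ^ (s - 1)) + 1 / (2 * (c + J) ^ s) +
    ∑ k ∈ Finset.Icc 1 ν, cs.getD k 0 * (s.ascFactorial (2 * k - 1) : ℚ) / (c + J) ^ (s + 2 * k - 1)

/-- `hurwitzNatMain` with the Bernoulli numbers spelled out (the memoised coefficient list `ZetaNumerics.emCoeffList ν` holds
`B_{2k}/(2k)!`, `ZetaNumerics.emCoeffList_getD`). [cite: DLMF, 25.11.5] -/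
theorem hurwitzNatMain_eq (c : ℚ) (J ν s : ℕ) : hurwitzNatMain c J ν s =
    (∑ k ∈ Finset.range J, 1 / ((k : ℚ) + c) ^ s) +
      1 / (((s : ℚ) - 1) * (c + J) ^ (s - 1)) + 1 / (2 * (c + J) ^ s) +
      ∑ k ∈ Finset.Icc 1 ν, bernoulli (2 * k) / (2 * k).factorial * (s.ascFactorial (2 * k - 1) : ℚ) /
        (c + J) ^ (s + 2 * k - 1) := by
  rw [hurwitzNatMain]
  congr 1
  refine Finset.sum_congr rfl fun k hk ↦ ?_
  have hk : k < ν + 2 := by have := (Finset.mem_Icc.1 hk).2; omega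
  rw [ZetaNumerics.emCoeffList_getD hk, ZetaNumerics.emCoeff]

/-- The rational majorant `s^{(2ν+1)}·(33/10)(25/157)^{2ν+1}/(c+J)^{s+2ν}` of the Euler–Maclaurin remainder of
`hurwitzNatMain` (`π²/3 ≤ 33/10`, `1/(2π) ≤ 25/157`). [cite: DLMF, 25.11.5] -/
def hurwitzNatTail (c : ℚ) (J ν s : ℕ) : ℚ :=
  (s.ascFactorial (2 * ν + 1) : ℚ) * ((33 / 10 : ℚ) * (25 / 157) ^ (2 * ν + 1)) / (c + J) ^ (s + 2 * ν)

/-- `π²/3·(2ν+1)!/(2π)^{2ν+1} ≤ (2ν+1)!·(33/10)(25/157)^{2ν+1}`. [folklore] -/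
private lemma pi_factor_le_rat (ν : ℕ) :
    Real.pi ^ 2 / 3 * ((2 * ν + 1).factorial : ℝ) / (2 * Real.pi) ^ (2 * ν + 1) ≤
      ((2 * ν + 1).factorial : ℝ) * ((33 / 10 : ℝ) * (25 / 157) ^ (2 * ν + 1)) := by
  have hπ3 := Real.pi_gt_d2
  have hπ4 := Real.pi_lt_d4
  have h1 : Real.pi ^ 2 / 3 / (2 * Real.pi) ^ (2 * ν + 1) ≤ (33 / 10 : ℝ) * (25 / 157) ^ (2 * ν + 1) := by
    rw [div_le_iff₀ (by positivity)]
    have hA : Real.pi ^ 2 / 3 ≤ 33 / 10 := by nlinarith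
    have hB : (1 : ℝ) ≤ (25 / 157) ^ (2 * ν + 1) * (2 * Real.pi) ^ (2 * ν + 1) := by
      rw [← mul_pow]
      exact one_le_pow₀ (by nlinarith)
    nlinarith
  have e : Real.pi ^ 2 / 3 * ((2 * ν + 1).factorial : ℝ) / (2 * Real.pi) ^ (2 * ν + 1) =
      ((2 * ν + 1).factorial : ℝ) * (Real.pi ^ 2 / 3 / (2 * Real.pi) ^ (2 * ν + 1)) := by ring
  rw [e]
  exact mul_le_mul_of_nonneg_left h1 (Nat.cast_nonneg _)

/-- **Kernel form of the Euler–Maclaurin enclosure of `Σ_{k≥0} (k+c)^{−s}`** (`c > 0` rational, integers `s ≥ 2`,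
`J`, `ν ≥ 1`): the series is summable and `|Σ_{k≥0} (k+c)^{−s} − hurwitzNatMain c J ν s| ≤ hurwitzNatTail c J ν s`.
With `c = 1` these are `ζ(s)`; with `c = ¼` they give `ψ^{(s−1)}(¼) = (−1)^s (s−1)! Σ_k (k+¼)^{−s}` and the main parts
of the C∞ window constants. [cite: DLMF, 25.11.5] -/
theorem abs_tsum_inv_pow_sub_hurwitzNatMain_le {c : ℚ} (hc : 0 < c) {s : ℕ} (hs : 2 ≤ s) (J : ℕ) {ν : ℕ}
    (hν : ν ≠ 0) :
    Summable (fun k : ℕ ↦ (((k : ℝ) + c) ^ s)⁻¹) ∧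
      |∑' k : ℕ, (((k : ℝ) + c) ^ s)⁻¹ - (hurwitzNatMain c J ν s : ℝ)| ≤ (hurwitzNatTail c J ν s : ℝ) := by
  obtain ⟨p, rfl⟩ : ∃ p, s = p + 1 := ⟨s - 1, by omega⟩
  have hp : 1 ≤ p := by omega
  have hwre : 0 < (((c : ℝ) : ℂ)).re := by simp; exact_mod_cast hc
  -- summability over `ℝ` from the complex statement
  have hsumC := summable_inv_pow_add_nat hwre hp
  have hterm : ∀ k : ℕ, ((((c : ℝ) : ℂ) + k) ^ (p + 1))⁻¹ = ((((((k : ℝ) + c) ^ (p + 1))⁻¹ : ℝ)) : ℂ) := by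
    intro k
    push_cast
    ring
  have hsumR : Summable (fun k : ℕ ↦ (((k : ℝ) + c) ^ (p + 1))⁻¹) := by
    have h2 : Summable (fun k : ℕ ↦ ((((((k : ℝ) + c) ^ (p + 1))⁻¹ : ℝ)) : ℂ)) := hsumC.congr hterm
    exact (Complex.summable_ofReal).1 h2
  refine ⟨hsumR, ?_⟩
  -- the shifted point `c + J`
  have hcJ : (0 : ℝ) < (c : ℝ) + J := by positivity
  have hwJre : ((((c : ℝ) + J : ℝ)) : ℂ).re = (c : ℝ) + J := by simp
  have hwJpos : 0 < ((((c : ℝ) + J : ℝ)) : ℂ).re := by rw [hwJre]; exact hcJ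
  have hwJnorm : ‖((((c : ℝ) + J : ℝ)) : ℂ)‖ = (c : ℝ) + J := by
    rw [Complex.norm_real, Real.norm_eq_abs, abs_of_pos hcJ]
  have hmain := norm_tsum_inv_pow_sub_stirling_le hwJpos hp hν
  rw [hwJnorm, hwJre] at hmain
  have hshift := tsum_inv_pow_eq_sum_add_tsum_shift hwre hp J
  have hwJ : (((c : ℝ) : ℂ)) + (J : ℂ) = ((((c : ℝ) + J : ℝ)) : ℂ) := by push_cast; ring
  rw [hwJ] at hshift
  -- the complex tsum is the real one
  have htsumC : ∑' k : ℕ, ((((c : ℝ) : ℂ) + k) ^ (p + 1))⁻¹ =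
      ((∑' k : ℕ, (((k : ℝ) + c) ^ (p + 1))⁻¹ : ℝ) : ℂ) := by
    rw [Complex.ofReal_tsum]
    exact tsum_congr hterm
  -- the main terms are the rational ones
  have e1 : p + 1 - 1 = p := by omega
  have e2 : ∀ k, p + 1 + 2 * k - 1 = p + 2 * k := fun k ↦ by omega
  have hMain : (∑ j ∈ Finset.range J, ((((c : ℝ) : ℂ) + j) ^ (p + 1))⁻¹) +
      (1 / (p * ((((c : ℝ) + J : ℝ)) : ℂ) ^ p) + 1 / (2 * ((((c : ℝ) + J : ℝ)) : ℂ) ^ (p + 1)) +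
        ∑ k ∈ Finset.Icc 1 ν, (bernoulli (2 * k) : ℂ) / (2 * k).factorial *
          ((p + 1).ascFactorial (2 * k - 1) : ℂ) / ((((c : ℝ) + J : ℝ)) : ℂ) ^ (p + 2 * k)) =
      ((hurwitzNatMain c J ν (p + 1) : ℚ) : ℂ) := by
    rw [hurwitzNatMain_eq, e1]
    simp only [e2]
    push_cast
    have hs1 : ∑ j ∈ Finset.range J, (((c : ℂ) + (j : ℂ)) ^ (p + 1))⁻¹ =
        ∑ k ∈ Finset.range J, 1 / (((k : ℂ) + (c : ℂ)) ^ (p + 1)) :=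
      Finset.sum_congr rfl fun k _ ↦ by rw [one_div, add_comm]
    rw [hs1]
    ring
  have hTail : (((p + 1).ascFactorial (2 * ν + 1) : ℝ) / (2 * ν + 1).factorial) *
        (Real.pi ^ 2 / 3 * ((2 * ν + 1).factorial : ℝ) / (2 * Real.pi) ^ (2 * ν + 1)) /
        (((c : ℝ) + J) ^ (p + 2 * ν) * ((c : ℝ) + J)) ≤ (hurwitzNatTail c J ν (p + 1) : ℝ) := by
    rw [hurwitzNatTail]
    have e3 : p + 1 + 2 * ν = p + 2 * ν + 1 := by ring
    rw [e3]
    push_cast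
    rw [pow_succ]
    have hfac : (0 : ℝ) < ((2 * ν + 1).factorial : ℝ) := by positivity
    have hquot : Real.pi ^ 2 / 3 * ((2 * ν + 1).factorial : ℝ) / (2 * Real.pi) ^ (2 * ν + 1) /
        ((2 * ν + 1).factorial : ℝ) ≤ (33 / 10 : ℝ) * (25 / 157) ^ (2 * ν + 1) := by
      rw [div_le_iff₀ hfac]
      have := pi_factor_le_rat ν
      linarith
    have hD : (0 : ℝ) < ((c : ℝ) + J) ^ (p + 2 * ν) * ((c : ℝ) + J) := by positivity
    calc (((p + 1).ascFactorial (2 * ν + 1) : ℝ) / (2 * ν + 1).factorial) *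
          (Real.pi ^ 2 / 3 * ((2 * ν + 1).factorial : ℝ) / (2 * Real.pi) ^ (2 * ν + 1)) /
          (((c : ℝ) + J) ^ (p + 2 * ν) * ((c : ℝ) + J))
        = ((p + 1).ascFactorial (2 * ν + 1) : ℝ) *
            (Real.pi ^ 2 / 3 * ((2 * ν + 1).factorial : ℝ) / (2 * Real.pi) ^ (2 * ν + 1) /
              ((2 * ν + 1).factorial : ℝ)) / (((c : ℝ) + J) ^ (p + 2 * ν) * ((c : ℝ) + J)) := by
          field_simp
      _ ≤ ((p + 1).ascFactorial (2 * ν + 1) : ℝ) * ((33 / 10 : ℝ) * (25 / 157) ^ (2 * ν + 1)) /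
            (((c : ℝ) + J) ^ (p + 2 * ν) * ((c : ℝ) + J)) := by
          gcongr
  -- assemble
  have hdiff : ((∑' k : ℕ, (((k : ℝ) + c) ^ (p + 1))⁻¹ : ℝ) : ℂ) - ((hurwitzNatMain c J ν (p + 1) : ℚ) : ℂ) =
      (∑' j : ℕ, ((((((c : ℝ) + J : ℝ)) : ℂ) + j) ^ (p + 1))⁻¹) -
        (1 / (p * ((((c : ℝ) + J : ℝ)) : ℂ) ^ p) + 1 / (2 * ((((c : ℝ) + J : ℝ)) : ℂ) ^ (p + 1)) +
        ∑ k ∈ Finset.Icc 1 ν, (bernoulli (2 * k) : ℂ) / (2 * k).factorial *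
          ((p + 1).ascFactorial (2 * k - 1) : ℂ) / ((((c : ℝ) + J : ℝ)) : ℂ) ^ (p + 2 * k)) := by
    rw [← htsumC, hshift, ← hMain]
    ring
  have hnormeq : ‖((∑' k : ℕ, (((k : ℝ) + c) ^ (p + 1))⁻¹ : ℝ) : ℂ) - ((hurwitzNatMain c J ν (p + 1) : ℚ) : ℂ)‖ =
      |∑' k : ℕ, (((k : ℝ) + c) ^ (p + 1))⁻¹ - (hurwitzNatMain c J ν (p + 1) : ℝ)| := by
    rw [show ((hurwitzNatMain c J ν (p + 1) : ℚ) : ℂ) = (((hurwitzNatMain c J ν (p + 1) : ℚ) : ℝ) : ℂ) from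
      (Complex.ofReal_ratCast _).symm, ← Complex.ofReal_sub, Complex.norm_real, Real.norm_eq_abs]
  rw [← hnormeq, hdiff]
  exact hmain.trans hTail

end Literature.Analysis.SpecialFunctions

end
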